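import Mathlib.Data.Matrix.Basic
import Mathlib.Algebra.BigOperators.Ring.Finset
import Mathlib.Data.Real.Basic
import Mathlib.Data.Fintype.BigOperators
import Mathlib.Tactic.Ring
import HarnessLib

/-!
# Kunisky–Yu §3.4–§3.5: the fifteen graph-matrix shapes of the disjoint block as five sums

Pure matrix bookkeeping for the proof of Kunisky–Yu 2022, Theorem 1.2 (arXiv:2211.02713): the
expansion (52)/(54) of `∏(1 + S_{ac})(1 + S_{ad})(1 + S_{bc})(1 + S_{bd}) − 1` into the graph
matrices `T^{4,1,1}, T^{4,2,1}, T^{4,2,2}, T^{4,2,3}, T^{4,3,1}, T^{4,4,1}` of Table 1, written as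
quadratic forms `Σ_{a,b,c,d} Vm_{ab}Vm_{cd}·(monomial)` for a symmetric `Vm` and a symmetric `S`,
and
grouped by shape:

* four single edges (`T^{4,1,1}`) each equal `gᵀSg` (`g_a = Σ_b Vm_{ab}`);
* four adjacent pairs (`T^{4,2,1}`, `T^{4,2,2}`) each equal `Σ_a g_a (S Vm S)_{aa}`;
* two opposite pairs (`T^{4,2,3}`) each equal `tr(Vm S Vm S)`;
* four triples (`T^{4,3,1}`) each equal `ρ = Σ_{a,c} S_{ac}(Vm S)_{ac}(S Vm)_{ac}`;
* the 4-cycle (`T^{4,4,1}`) `Θ = Σ Vm_{ab}Vm_{cd}S_{ac}S_{ad}S_{bc}S_{bd}`.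

Main statement: `sum_prod_sub_one_eq` —
`Σ Vm_{ab}Vm_{cd}(∏(1+S) − 1) = 4·gᵀSg + 4·Σ_a g_a(SVmS)_{aa} + 2·tr(VmSVmS) + 4ρ + Θ`.

## References

* [KuniskyYu2022] D. Kunisky, X. Yu, arXiv:2211.02713, (52), (54), Table 1.
-/

noncomputable section

namespace Literature.Combinatorics.SimpleGraph

open Matrix Finset

section ShapeIdentities

variable {V : Type*} [Fintype V]

/-! ### Reindexing four-fold sums -/

/-- Swap the first two of four summation variables. [folklore] -/
theorem sum4_swap12 (f : V → V → V → V → ℝ) :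
    ∑ a, ∑ b, ∑ c, ∑ d, f a b c d = ∑ a, ∑ b, ∑ c, ∑ d, f b a c d :=
  Finset.sum_comm

/-- Swap the middle two of four summation variables. [folklore] -/
theorem sum4_swap23 (f : V → V → V → V → ℝ) :
    ∑ a, ∑ b, ∑ c, ∑ d, f a b c d = ∑ a, ∑ b, ∑ c, ∑ d, f a c b d :=
  Finset.sum_congr rfl fun _ _ => Finset.sum_comm

/-- Swap the last two of four summation variables. [folklore] -/
theorem sum4_swap34 (f : V → V → V → V → ℝ) :
    ∑ a, ∑ b, ∑ c, ∑ d, f a b c d = ∑ a, ∑ b, ∑ c, ∑ d, f a b d c :=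
  Finset.sum_congr rfl fun _ _ => Finset.sum_congr rfl fun _ _ => Finset.sum_comm

/-- Swap the two pairs of summation variables: `(a,b,c,d) ↦ (c,d,a,b)`. [folklore] -/
theorem sum4_swapBlocks (f : V → V → V → V → ℝ) :
    ∑ a, ∑ b, ∑ c, ∑ d, f a b c d = ∑ a, ∑ b, ∑ c, ∑ d, f c d a b := by
  rw [sum4_swap23 f, sum4_swap12, sum4_swap34, sum4_swap23]

variable (S Vm : Matrix V V ℝ)

/-! ### The five canonical shapes as four-fold sums -/

/-- `gᵀSg = Σ Vm_{ab}Vm_{cd}S_{ac}` (`g = Vm𝟙`; shape `T^{4,1,1}`).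
[cite: KuniskyYu2022, Table 1] -/
theorem gSg_eq_sum4 :
    ∑ a, ∑ c, (∑ b, Vm a b) * S a c * (∑ d, Vm c d) =
      ∑ a, ∑ b, ∑ c, ∑ d, Vm a b * Vm c d * S a c := by
  rw [sum4_swap23]
  refine Finset.sum_congr rfl fun a _ => Finset.sum_congr rfl fun c _ => ?_
  rw [Finset.sum_mul, Finset.sum_mul]
  refine Finset.sum_congr rfl fun b _ => ?_
  rw [Finset.mul_sum]
  exact Finset.sum_congr rfl fun d _ => by ring

/-- `Σ_a g_a (SVmS)_{aa} = Σ Vm_{ab}Vm_{cd}S_{ac}S_{ad}` for `S` symmetric (shapes `T^{4,2,1}`,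
`T^{4,2,2}`). [cite: KuniskyYu2022, Table 1] -/
theorem gl_eq_sum4 (hSs : ∀ x y, S x y = S y x) :
    ∑ a, (∑ b, Vm a b) * (∑ c, ∑ d, S a c * Vm c d * S d a) =
      ∑ a, ∑ b, ∑ c, ∑ d, Vm a b * Vm c d * (S a c * S a d) := by
  refine Finset.sum_congr rfl fun a _ => ?_
  rw [Finset.sum_mul]
  refine Finset.sum_congr rfl fun b _ => ?_
  rw [Finset.mul_sum]
  refine Finset.sum_congr rfl fun c _ => ?_
  rw [Finset.mul_sum]
  exact Finset.sum_congr rfl fun d _ => by rw [hSs d a]; ring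

/-- `tr(VmSVmS) = Σ Vm_{ab}Vm_{cd}S_{ad}S_{bc}` for `S` symmetric (shape `T^{4,2,3}`).
[cite: KuniskyYu2022, Table 1] -/
theorem trVSVS_eq_sum4 (hSs : ∀ x y, S x y = S y x) :
    ∑ a, ∑ b, ∑ c, ∑ d, Vm a b * S b c * Vm c d * S d a =
      ∑ a, ∑ b, ∑ c, ∑ d, Vm a b * Vm c d * (S a d * S b c) :=
  Finset.sum_congr rfl fun a _ => Finset.sum_congr rfl fun b _ => Finset.sum_congr rfl fun c _ =>
    Finset.sum_congr rfl fun d _ => by rw [hSs d a]; ring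

/-- `ρ = Σ_{a,c} S_{ac}(VmS)_{ac}(SVm)_{ac} = Σ Vm_{ab}Vm_{cd}S_{ac}S_{ad}S_{bc}` for `Vm` symmetric
(shape `T^{4,3,1}`). [cite: KuniskyYu2022, Table 1] -/
theorem rho_eq_sum4 (hVs : ∀ x y, Vm x y = Vm y x) :
    ∑ a, ∑ c, S a c * (∑ b, Vm a b * S b c) * (∑ d, S a d * Vm d c) =
      ∑ a, ∑ b, ∑ c, ∑ d, Vm a b * Vm c d * (S a c * S a d * S b c) := by
  rw [sum4_swap23]
  refine Finset.sum_congr rfl fun a _ => Finset.sum_congr rfl fun c _ => ?_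
  rw [Finset.mul_sum univ (fun b => Vm a b * S b c) (S a c), Finset.sum_mul]
  refine Finset.sum_congr rfl fun b _ => ?_
  rw [Finset.mul_sum]
  exact Finset.sum_congr rfl fun d _ => by rw [hVs d c]; ring

/-! ### The fifteen monomials -/

/-- **The disjoint-block shapes** (KY (52) third case and (54)): for `S`, `Vm` symmetric,
`Σ_{a,b,c,d} Vm_{ab}Vm_{cd}·((1+S_{ac})(1+S_{ad})(1+S_{bc})(1+S_{bd}) − 1)`
` = 4·gᵀSg + 4·Σ_a g_a(SVmS)_{aa} + 2·tr(VmSVmS) + 4ρ + Θ`, with `g_a = Σ_b Vm_{ab}`,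
`ρ = Σ_{a,c} S_{ac}(VmS)_{ac}(SVm)_{ac}` and `Θ = Σ Vm_{ab}Vm_{cd}S_{ac}S_{ad}S_{bc}S_{bd}`
(`T^{4,4,1}`).
[cite: KuniskyYu2022, (54)] -/
theorem sum_prod_sub_one_eq (hSs : ∀ x y, S x y = S y x) (hVs : ∀ x y, Vm x y = Vm y x) :
    ∑ a, ∑ b, ∑ c, ∑ d, Vm a b * Vm c d *
      ((1 + S a c) * (1 + S a d) * (1 + S b c) * (1 + S b d) - 1) =
      4 * ∑ a, ∑ c, (∑ b, Vm a b) * S a c * (∑ d, Vm c d) +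
      4 * ∑ a, (∑ b, Vm a b) * (∑ c, ∑ d, S a c * Vm c d * S d a) +
      2 * ∑ a, ∑ b, ∑ c, ∑ d, Vm a b * S b c * Vm c d * S d a +
      4 * ∑ a, ∑ c, S a c * (∑ b, Vm a b * S b c) * (∑ d, S a d * Vm d c) +
      ∑ a, ∑ b, ∑ c, ∑ d, Vm a b * Vm c d * (S a c * S a d * S b c * S b d) := by
  rw [gSg_eq_sum4, gl_eq_sum4 S Vm hSs, trVSVS_eq_sum4 S Vm hSs, rho_eq_sum4 S Vm hVs]
  -- expand the product into monomials
  have e : ∀ a b c d, Vm a b * Vm c d *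
      ((1 + S a c) * (1 + S a d) * (1 + S b c) * (1 + S b d) - 1) =
      Vm a b * Vm c d * S a c + Vm a b * Vm c d * S a d + Vm a b * Vm c d * S b c +
        Vm a b * Vm c d * S b d +
      (Vm a b * Vm c d * (S a c * S a d) + Vm a b * Vm c d * (S b c * S b d) +
        Vm a b * Vm c d * (S a c * S b c) + Vm a b * Vm c d * (S a d * S b d)) +
      (Vm a b * Vm c d * (S a c * S b d) + Vm a b * Vm c d * (S a d * S b c)) +
      (Vm a b * Vm c d * (S a c * S a d * S b c) + Vm a b * Vm c d * (S a c * S a d * S b d) +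
        Vm a b * Vm c d * (S a c * S b c * S b d) + Vm a b * Vm c d * (S a d * S b c * S b d)) +
      Vm a b * Vm c d * (S a c * S a d * S b c * S b d) := by
    intro a b c d; ring
  simp only [e, Finset.sum_add_distrib]
  -- singles
  have m2 : ∑ a, ∑ b, ∑ c, ∑ d, Vm a b * Vm c d * S a d =
      ∑ a, ∑ b, ∑ c, ∑ d, Vm a b * Vm c d * S a c := by
    rw [sum4_swap34]
    exact Finset.sum_congr rfl fun a _ => Finset.sum_congr rfl fun b _ =>
      Finset.sum_congr rfl fun c _ => Finset.sum_congr rfl fun d _ => by rw [hVs d c]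
  have m3 : ∑ a, ∑ b, ∑ c, ∑ d, Vm a b * Vm c d * S b c =
      ∑ a, ∑ b, ∑ c, ∑ d, Vm a b * Vm c d * S a c := by
    rw [sum4_swap12]
    exact Finset.sum_congr rfl fun a _ => Finset.sum_congr rfl fun b _ =>
      Finset.sum_congr rfl fun c _ => Finset.sum_congr rfl fun d _ => by rw [hVs b a]
  have m4 : ∑ a, ∑ b, ∑ c, ∑ d, Vm a b * Vm c d * S b d =
      ∑ a, ∑ b, ∑ c, ∑ d, Vm a b * Vm c d * S a c := by
    rw [sum4_swap12, sum4_swap34]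
    exact Finset.sum_congr rfl fun a _ => Finset.sum_congr rfl fun b _ =>
      Finset.sum_congr rfl fun c _ => Finset.sum_congr rfl fun d _ => by rw [hVs b a, hVs d c]
  -- adjacent pairs
  have p2 : ∑ a, ∑ b, ∑ c, ∑ d, Vm a b * Vm c d * (S b c * S b d) =
      ∑ a, ∑ b, ∑ c, ∑ d, Vm a b * Vm c d * (S a c * S a d) := by
    rw [sum4_swap12]
    exact Finset.sum_congr rfl fun a _ => Finset.sum_congr rfl fun b _ =>
      Finset.sum_congr rfl fun c _ => Finset.sum_congr rfl fun d _ => by rw [hVs b a]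
  have p3 : ∑ a, ∑ b, ∑ c, ∑ d, Vm a b * Vm c d * (S a c * S b c) =
      ∑ a, ∑ b, ∑ c, ∑ d, Vm a b * Vm c d * (S a c * S a d) := by
    rw [sum4_swapBlocks]
    exact Finset.sum_congr rfl fun a _ => Finset.sum_congr rfl fun b _ =>
      Finset.sum_congr rfl fun c _ => Finset.sum_congr rfl fun d _ => by
        rw [hSs c a, hSs d a]; ring
  have p4 : ∑ a, ∑ b, ∑ c, ∑ d, Vm a b * Vm c d * (S a d * S b d) =
      ∑ a, ∑ b, ∑ c, ∑ d, Vm a b * Vm c d * (S a c * S a d) := by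
    rw [sum4_swapBlocks, sum4_swap12]
    exact Finset.sum_congr rfl fun a _ => Finset.sum_congr rfl fun b _ =>
      Finset.sum_congr rfl fun c _ => Finset.sum_congr rfl fun d _ => by
        rw [hVs b a, hSs c a, hSs d a]; ring
  -- opposite pairs
  have o1 : ∑ a, ∑ b, ∑ c, ∑ d, Vm a b * Vm c d * (S a c * S b d) =
      ∑ a, ∑ b, ∑ c, ∑ d, Vm a b * Vm c d * (S a d * S b c) := by
    rw [sum4_swap34]
    exact Finset.sum_congr rfl fun a _ => Finset.sum_congr rfl fun b _ =>
      Finset.sum_congr rfl fun c _ => Finset.sum_congr rfl fun d _ => by rw [hVs d c]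
  -- triples
  have t2 : ∑ a, ∑ b, ∑ c, ∑ d, Vm a b * Vm c d * (S a c * S a d * S b d) =
      ∑ a, ∑ b, ∑ c, ∑ d, Vm a b * Vm c d * (S a c * S a d * S b c) := by
    rw [sum4_swap34]
    exact Finset.sum_congr rfl fun a _ => Finset.sum_congr rfl fun b _ =>
      Finset.sum_congr rfl fun c _ => Finset.sum_congr rfl fun d _ => by rw [hVs d c]; ring
  have t3 : ∑ a, ∑ b, ∑ c, ∑ d, Vm a b * Vm c d * (S a c * S b c * S b d) =
      ∑ a, ∑ b, ∑ c, ∑ d, Vm a b * Vm c d * (S a c * S a d * S b c) := by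
    rw [sum4_swap12]
    exact Finset.sum_congr rfl fun a _ => Finset.sum_congr rfl fun b _ =>
      Finset.sum_congr rfl fun c _ => Finset.sum_congr rfl fun d _ => by rw [hVs b a]; ring
  have t4 : ∑ a, ∑ b, ∑ c, ∑ d, Vm a b * Vm c d * (S a d * S b c * S b d) =
      ∑ a, ∑ b, ∑ c, ∑ d, Vm a b * Vm c d * (S a c * S a d * S b c) := by
    rw [sum4_swap12, sum4_swap34]
    exact Finset.sum_congr rfl fun a _ => Finset.sum_congr rfl fun b _ =>
      Finset.sum_congr rfl fun c _ => Finset.sum_congr rfl fun d _ => by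
        rw [hVs b a, hVs d c]; ring
  rw [m2, m3, m4, p2, p3, p4, o1, t2, t3, t4]
  ring

end ShapeIdentities

end Literature.Combinatorics.SimpleGraph

end
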